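import Mathlib.Analysis.Complex.ExponentialBounds
import Mathlib.Analysis.SpecialFunctions.Trigonometric.Bounds
import Mathlib.Analysis.Convex.SpecificFunctions.Deriv
import Mathlib.Analysis.Real.Pi.Bounds

/-!
# The finite certificate `SpillBudget` of LINE L64 «K1 DECIDED IN KERNEL — FINITE-STATE SPILL BUDGET» (stub B)

HONEST LABEL. Helper toward `¬ IntegerScrew.TwoPrimeFoldRigidity` (L62 K1 = item
stmt-RiemannHypothesis-25784), i.e. stub B `stub_spillBudget : SpillBudget` of the registered skeleton
`pub/ideators/rh-idea-2/g5/LINE-W04-finite-spill-budget.lean` (sha16 29cd1569c341fb40, namespace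
`Summit.RiemannHypothesis.RiemannHypothesis.Cruxes.TwoPrimeFold.FiniteSpillBudget`); record-negative
programme (a two-lattice BLINDNESS construction = negative knowledge about the sampling set
`ℕ⁺ log 2 ∪ ℕ⁺ log 3`); 0 toward RH.  RH is not proved, not used, not mentioned below.
Nothing here bears on the truth of RH.

WHAT IS PROVED. `spillBudget : SpillBudget` — the twelve closed-form real inequalities that make the
phase-type spill budget of the cubed product-gon two-lattice tower on `(log 2, log 3)` close with ratio
`θ = 17/20`: a four-digit enclosure of `H = log 3 / log 2`, the suprema of the first-cross factors
`ρ_D(δ) = [|sin πδ| / (H |sin(πδ/H)|)]³` and `ρ_S = ρ_D⁻¹` on the four phase intervals, `e^{-10/3} ≤ 0.036`,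
`(π·1.135/20)² ≤ 0.032`, and the rational weighted-ℓ¹ rows.  The definitions `H23`, `rhoD`, `rhoS`,
`SpillBudget` below are BYTE-VERBATIM the skeleton's (restated, not imported: the skeleton carries
sorries), so the skeleton's stub closes by `exact` after unfolding.

METHOD (elementary, kernel-checked, no `native_decide`, no external computation): `Real.pi_gt_d6/lt_d6`,
`Real.log_two/three_gt_d9/lt_d9`, `Real.exp_neg_one_lt_d9`, `Real.quadratic_le_exp_of_nonneg`; on each
phase interval the numerator is bounded through monotonicity of `sin`/`cos` plus `Real.cos_bound` /
`Real.sin_bound` at a small rational argument, the denominator through concavity of `sin` on `[0, π]`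
(`strictConcaveOn_sin_Icc`: the minimum over an interval is at an endpoint), the reflection
`sin x = sin (π - x)` for endpoints beyond `π/2`, and quarter-angle Taylor certificates
`sin 4w ≥ 2(2w − (2w)³/6)(2(1 − w²/2)² − 1)` (`Real.sin_ge_sub_cube`, `Real.one_sub_sq_div_two_le_cos`).
Pieces: `[0.45,0.46]`, `[0.46,0.55]` (ρ_D ≤ 0.53), `[0.55,1]` (ρ_D ≤ 0.36), `[1,1.135]` (ρ_D ≤ 0.041 ≤ 0.36),
`[0.45,0.55]` (ρ_S ≤ 2.95).  Design script (exact rationals): `pub/ideators/rh-idea-2/g5/stage/design2.py`.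

Seat: rh-idea-2 g5 (planner-rh-idea-2-g5-0), staged for the filer named by rh-split-lead RULING #516.
-/

set_option linter.dupNamespace false

noncomputable section

namespace Summit.RiemannHypothesis.RiemannHypothesis.Theorems.TwoPrimeFoldRigidity.Negative

/-! ## The statement (verbatim from the registered skeleton) -/

/-- `H = log 3 / log 2` (the sparse step in units of the dense step). -/
def H23 : ℝ := Real.log 3 / Real.log 2

/-- asymptotic first-cross factor of a DENSE-separated level into the next sparse time at phase distance `δ` (units of
`log 2`): `ρ_D(δ) = [ |sin πδ| / (H |sin(πδ/H)|) ]³ = [sinc(δ)/sinc(δ/H)]³`. -/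
def rhoD (δ : ℝ) : ℝ := (|Real.sin (Real.pi * δ)| / (H23 * |Real.sin (Real.pi * δ / H23)|)) ^ 3

/-- asymptotic first-cross factor of a SPARSE-separated level into the next dense time: `ρ_S(δ) = ρ_D(δ)⁻¹`. -/
def rhoS (δ : ℝ) : ℝ := (H23 * |Real.sin (Real.pi * δ / H23)| / |Real.sin (Real.pi * δ)|) ^ 3

/-- [B] THE FINITE CERTIFICATE of LINE L64 (verbatim the skeleton's `SpillBudget`): (i) a 4-digit enclosure of
`log 3/log 2`; (ii)–(v) the suprema of the first-cross factors over the phase interval of each separated type;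
(vi) long-range decay per own multiple at depth `c = 3/10`; (vii) the finite-order correction at `K₀ = 20`;
(viii) weighted-ℓ¹ closure rows, weights `(J, D0, D2, S, D1) = (1, 1, 1, 4, 3)`, ratio `θ = 17/20`. -/
def SpillBudget : Prop :=
  ((1.5849 : ℝ) ≤ H23 ∧ H23 ≤ 1.5850) ∧
  (∀ δ : ℝ, 0.55 ≤ δ → δ ≤ 1.135 → rhoD δ ≤ 0.36) ∧
  (∀ δ : ℝ, 0.45 ≤ δ → δ ≤ 0.55 → rhoD δ ≤ 0.53) ∧
  (∀ δ : ℝ, 0.45 ≤ δ → δ ≤ 0.55 → rhoS δ ≤ 2.95) ∧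
  (∀ δ : ℝ, 1.03 ≤ δ → δ ≤ 1.135 → rhoD δ ≤ 0.041) ∧
  (Real.exp (-(10 / 3 : ℝ)) ≤ 0.036) ∧
  ((Real.pi * 1.135 / 20) ^ 2 ≤ (0.032 : ℝ)) ∧
  ((2.95 : ℝ) * 1 + 0.06 * 4 ≤ (17 / 20) * 4 ∧ (0.53 : ℝ) * 4 + 0.06 * 4 ≤ (17 / 20) * 3 ∧
    (0.36 : ℝ) * 1 + 0.06 * 4 ≤ (17 / 20) * 1 ∧ (0.041 : ℝ) * 1 + 0.06 * 4 ≤ (17 / 20) * 1 ∧ (0.16 : ℝ) * 4 ≤ (17 / 20) * 1)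

/-! ## Elementary tools -/

/-- (i) the four-digit enclosure `1.5849 ≤ log 3 / log 2 ≤ 1.5850` (from `Real.log_two/three_gt/lt_d9`). -/
theorem H23_bounds : (1.5849 : ℝ) ≤ H23 ∧ H23 ≤ 1.5850 := by
  have h2l := Real.log_two_gt_d9
  have h2u := Real.log_two_lt_d9
  have h3l := Real.log_three_gt_d9
  have h3u := Real.log_three_lt_d9
  have hpos : 0 < Real.log 2 := by linarith
  unfold H23
  constructor
  · rw [le_div_iff₀ hpos]; nlinarith
  · rw [div_le_iff₀ hpos]; nlinarith

/-- `0 < log 3 / log 2`. -/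
theorem H23_pos : 0 < H23 := by linarith [H23_bounds.1]

/-- concavity of `sin` on `[0, π]`: on a sub-interval the minimum is at an endpoint. -/
theorem min_sin_le_sin_of_mem {a b x : ℝ} (ha : 0 ≤ a) (hb : b ≤ Real.pi) (hax : a ≤ x) (hxb : x ≤ b) :
    min (Real.sin a) (Real.sin b) ≤ Real.sin x := by
  have hab : a ≤ b := hax.trans hxb
  exact strictConcaveOn_sin_Icc.concaveOn.ge_on_segment (x := a) (y := b) (z := x)
    ⟨ha, hab.trans hb⟩ ⟨ha.trans hab, hb⟩ (by rw [segment_eq_Icc hab]; exact ⟨hax, hxb⟩)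

/-- a lower bound for `sin` valid at both endpoints of `[a, b] ⊆ [0, π]` holds on the whole interval (concavity of `sin`). -/
theorem le_sin_of_mem {a b x L : ℝ} (ha : 0 ≤ a) (hb : b ≤ Real.pi) (hax : a ≤ x) (hxb : x ≤ b)
    (hLa : L ≤ Real.sin a) (hLb : L ≤ Real.sin b) : L ≤ Real.sin x :=
  (le_min hLa hLb).trans (min_sin_le_sin_of_mem ha hb hax hxb)

/-- reflection: a lower bound for `sin c`, `0 ≤ c ≤ π - b`, `b ≥ π/2`, is a lower bound for `sin b`. -/
theorem le_sin_of_reflect {b c L : ℝ} (hL : L ≤ Real.sin c) (hc0 : 0 ≤ c) (hcb : c + b ≤ 3.141592)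
    (hb : 1.5707965 ≤ b) : L ≤ Real.sin b := by
  have hπ1 := Real.pi_gt_d6
  have hπ2 := Real.pi_lt_d6
  rw [← Real.sin_pi_sub]
  refine hL.trans (Real.sin_le_sin_of_le_of_le_pi_div_two ?_ ?_ ?_) <;> linarith [Real.pi_pos]

/-- quarter-angle Taylor LOWER certificate: `sin 4w ≥ 2·(2w − (2w)³/6)·(2(1 − w²/2)² − 1)`. -/
theorem sin_four_mul_ge (w : ℝ) (hw : 0 ≤ w) (hA : 0 ≤ 2 * w - (2 * w) ^ 3 / 6)
    (hB : 0 ≤ 2 * (1 - w ^ 2 / 2) ^ 2 - 1) (hC : 0 ≤ 1 - w ^ 2 / 2) :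
    2 * (2 * w - (2 * w) ^ 3 / 6) * (2 * (1 - w ^ 2 / 2) ^ 2 - 1) ≤ Real.sin (2 * (2 * w)) := by
  rw [Real.sin_two_mul, Real.cos_two_mul]
  have h1 : 2 * w - (2 * w) ^ 3 / 6 ≤ Real.sin (2 * w) := Real.sin_ge_sub_cube (by linarith)
  have h2 : 1 - w ^ 2 / 2 ≤ Real.cos w := Real.one_sub_sq_div_two_le_cos
  have h3 : (1 - w ^ 2 / 2) ^ 2 ≤ Real.cos w ^ 2 := pow_le_pow_left₀ hC h2 2
  have h4 : 2 * (1 - w ^ 2 / 2) ^ 2 - 1 ≤ 2 * Real.cos w ^ 2 - 1 := by linarith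
  have h5 : 0 ≤ Real.sin (2 * w) := hA.trans h1
  have h6 := mul_le_mul h1 h4 hB h5
  nlinarith [h6]

/-- quarter-angle Taylor UPPER certificate (`2v ≤ 1`): `sin 4v ≤ 2·(2v − (2v)³/6 + (2v)⁵/100)·(1 − 2(v − v³/6)²)`. -/
theorem sin_four_mul_le (v : ℝ) (hv : 0 ≤ v) (hv1 : 2 * v ≤ 1) (hs : 0 ≤ v - v ^ 3 / 6)
    (hU : 0 ≤ 2 * v - (2 * v) ^ 3 / 6 + (2 * v) ^ 5 / 100) :
    Real.sin (2 * (2 * v)) ≤ 2 * (2 * v - (2 * v) ^ 3 / 6 + (2 * v) ^ 5 / 100) * (1 - 2 * (v - v ^ 3 / 6) ^ 2) := by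
  rw [Real.sin_two_mul]
  have hπ := Real.pi_gt_three
  have hb := Real.sin_bound (x := 2 * v) (by rw [abs_of_nonneg (by linarith)]; exact hv1)
  have h1 : Real.sin (2 * v) ≤ 2 * v - (2 * v) ^ 3 / 6 + (2 * v) ^ 5 / 100 := by
    have h := (abs_sub_le_iff.1 hb).1
    rw [abs_of_nonneg (by linarith : (0:ℝ) ≤ 2 * v)] at h
    linarith
  have h2 : v - v ^ 3 / 6 ≤ Real.sin v := Real.sin_ge_sub_cube hv
  have h3 : (v - v ^ 3 / 6) ^ 2 ≤ Real.sin v ^ 2 := pow_le_pow_left₀ hs h2 2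
  have hcos2 : Real.cos (2 * v) = 1 - 2 * Real.sin v ^ 2 := by
    have e1 := Real.cos_two_mul v
    have e2 := Real.sin_sq_add_cos_sq v
    linarith
  have h4 : Real.cos (2 * v) ≤ 1 - 2 * (v - v ^ 3 / 6) ^ 2 := by rw [hcos2]; linarith
  have h5 : 0 ≤ Real.cos (2 * v) :=
    Real.cos_nonneg_of_neg_pi_div_two_le_of_le (by linarith) (by linarith)
  have h6 : 0 ≤ Real.sin (2 * v) := Real.sin_nonneg_of_nonneg_of_le_pi (by linarith) (by linarith)
  have h7 := mul_le_mul h1 h4 h5 hU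
  nlinarith [h7]

/-- `cos y ≤ 1 − y²/2 + (5/96) y⁴` for `0 ≤ y ≤ 1` (`Real.cos_bound`). -/
theorem cos_le_taylor {y : ℝ} (h0 : 0 ≤ y) (h1 : y ≤ 1) : Real.cos y ≤ 1 - y ^ 2 / 2 + y ^ 4 * (5 / 96) := by
  have hb := Real.cos_bound (x := y) (by rw [abs_of_nonneg h0]; exact h1)
  have h := (abs_sub_le_iff.1 hb).1
  rw [abs_of_nonneg h0] at h
  linarith

/-- `sin x ≤ x − x³/6 + x⁵/100` for `0 ≤ x ≤ 1` (`Real.sin_bound`). -/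
theorem sin_le_taylor {x : ℝ} (h0 : 0 ≤ x) (h1 : x ≤ 1) : Real.sin x ≤ x - x ^ 3 / 6 + x ^ 5 / 100 := by
  have hb := Real.sin_bound (x := x) (by rw [abs_of_nonneg h0]; exact h1)
  have h := (abs_sub_le_iff.1 hb).1
  rw [abs_of_nonneg h0] at h
  linarith

/-! ## The four lower certificates and the one upper certificate for `sin` at rational points -/

/-- `sin 0.89168 ≥ 0.777518` (`0.89168 = 4·0.22292`). -/
theorem sin_cert_a1 : (0.777518 : ℝ) ≤ Real.sin (2 * (2 * 0.22292)) :=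
  le_trans (by norm_num) (sin_four_mul_ge 0.22292 (by norm_num) (by norm_num) (by norm_num) (by norm_num))

/-- `sin 0.9117 ≥ 0.789867` (`0.9117 = 4·0.227925`). -/
theorem sin_cert_a2 : (0.789867 : ℝ) ≤ Real.sin (2 * (2 * 0.227925)) :=
  le_trans (by norm_num) (sin_four_mul_ge 0.227925 (by norm_num) (by norm_num) (by norm_num) (by norm_num))

/-- `sin 1.09 ≥ 0.885031` (`1.09 = 4·0.2725`). -/
theorem sin_cert_a3 : (0.885031 : ℝ) ≤ Real.sin (2 * (2 * 0.2725)) :=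
  le_trans (by norm_num) (sin_four_mul_ge 0.2725 (by norm_num) (by norm_num) (by norm_num) (by norm_num))

/-- `sin 1.1592 ≥ 0.914349` (`1.1592 = 4·0.2898`). -/
theorem sin_cert_c : (0.914349 : ℝ) ≤ Real.sin (2 * (2 * 0.2898)) :=
  le_trans (by norm_num) (sin_four_mul_ge 0.2898 (by norm_num) (by norm_num) (by norm_num) (by norm_num))

/-- `sin 1.0904 ≤ 0.886968` (`1.0904 = 4·0.2726`). -/
theorem sin_cert_u : Real.sin (2 * (2 * 0.2726)) ≤ (0.886968 : ℝ) :=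
  le_trans (sin_four_mul_le 0.2726 (by norm_num) (by norm_num) (by norm_num) (by norm_num)) (by norm_num)

/-! ## Combination lemmas -/

/-- `ρ_D(δ) ≤ c` from an upper bound `U` on the numerator `|sin πδ|` and a lower bound `B > 0` on the denominator with `(U/B)³ ≤ c`. -/
theorem rhoD_le_of_bounds {δ U B c : ℝ} (hU : |Real.sin (Real.pi * δ)| ≤ U)
    (hB : B ≤ H23 * |Real.sin (Real.pi * δ / H23)|) (hBpos : 0 < B) (hc : (U / B) ^ 3 ≤ c) :
    rhoD δ ≤ c := by
  unfold rhoD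
  have h0 : 0 ≤ |Real.sin (Real.pi * δ)| := abs_nonneg _
  have hr : |Real.sin (Real.pi * δ)| / (H23 * |Real.sin (Real.pi * δ / H23)|) ≤ U / B :=
    div_le_div₀ (h0.trans hU) hU hBpos hB
  have hr0 : 0 ≤ |Real.sin (Real.pi * δ)| / (H23 * |Real.sin (Real.pi * δ / H23)|) :=
    div_nonneg h0 (hBpos.le.trans hB)
  exact (pow_le_pow_left₀ hr0 hr 3).trans hc

/-- `ρ_S(δ) ≤ c` from an upper bound `U` on the numerator `H |sin(πδ/H)|` and a lower bound `B > 0` on the denominator with `(U/B)³ ≤ c`. -/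
theorem rhoS_le_of_bounds {δ U B c : ℝ} (hU : H23 * |Real.sin (Real.pi * δ / H23)| ≤ U)
    (hB : B ≤ |Real.sin (Real.pi * δ)|) (hBpos : 0 < B) (hc : (U / B) ^ 3 ≤ c) :
    rhoS δ ≤ c := by
  unfold rhoS
  have h0 : 0 ≤ H23 * |Real.sin (Real.pi * δ / H23)| := mul_nonneg H23_pos.le (abs_nonneg _)
  have hr : H23 * |Real.sin (Real.pi * δ / H23)| / |Real.sin (Real.pi * δ)| ≤ U / B :=
    div_le_div₀ (h0.trans hU) hU hBpos hB
  have hr0 : 0 ≤ H23 * |Real.sin (Real.pi * δ / H23)| / |Real.sin (Real.pi * δ)| :=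
    div_nonneg h0 (hBpos.le.trans hB)
  exact (pow_le_pow_left₀ hr0 hr 3).trans hc

/-! ## The five pieces -/

/-- P1: `δ ∈ [0.45, 0.46]` — numerator via `cos (π(1/2 − δ)) ≤ cos 0.125663`, denominator on `[0.89168, 1.09]`. -/
theorem rhoD_le_piece1 {δ : ℝ} (h1 : (0.45 : ℝ) ≤ δ) (h2 : δ ≤ 0.46) : rhoD δ ≤ 0.53 := by
  obtain ⟨hH1, hH2⟩ := H23_bounds
  have hHpos := H23_pos
  have hπ1 := Real.pi_gt_d6
  have hπ2 := Real.pi_lt_d6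
  have hnum : |Real.sin (Real.pi * δ)| ≤ 0.992118 := by
    rw [← Real.cos_pi_div_two_sub (Real.pi * δ)]
    have ht0 : (0.125663 : ℝ) ≤ Real.pi / 2 - Real.pi * δ := by nlinarith
    have ht1 : Real.pi / 2 - Real.pi * δ ≤ Real.pi / 2 := by nlinarith
    have hc0 : 0 ≤ Real.cos (Real.pi / 2 - Real.pi * δ) :=
      Real.cos_nonneg_of_neg_pi_div_two_le_of_le (by linarith) ht1
    rw [abs_of_nonneg hc0]
    have hmono : Real.cos (Real.pi / 2 - Real.pi * δ) ≤ Real.cos 0.125663 :=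
      Real.cos_le_cos_of_nonneg_of_le_pi (by norm_num) (by linarith) ht0
    have htay := cos_le_taylor (y := (0.125663 : ℝ)) (by norm_num) (by norm_num)
    exact hmono.trans (htay.trans (by norm_num))
  have hx1 : 2 * (2 * 0.22292) ≤ Real.pi * δ / H23 := by
    rw [le_div_iff₀ hHpos]; nlinarith [mul_nonneg (sub_nonneg.2 hπ1.le) (sub_nonneg.2 h1)]
  have hx2 : Real.pi * δ / H23 ≤ 2 * (2 * 0.2725) := by
    rw [div_le_iff₀ hHpos]; nlinarith [mul_nonneg (sub_nonneg.2 hπ2.le) (sub_nonneg.2 h1)]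
  have hsin : (0.777518 : ℝ) ≤ Real.sin (Real.pi * δ / H23) :=
    le_sin_of_mem (by norm_num) (by linarith) hx1 hx2 sin_cert_a1 (le_trans (by norm_num) sin_cert_a3)
  have hden : (1.5849 : ℝ) * 0.777518 ≤ H23 * |Real.sin (Real.pi * δ / H23)| := by
    rw [abs_of_nonneg (by linarith)]
    exact mul_le_mul hH1 hsin (by norm_num) hHpos.le
  exact rhoD_le_of_bounds hnum hden (by norm_num) (by norm_num)

/-- P2: `δ ∈ [0.46, 0.55]` — numerator `≤ 1`, denominator on `[0.9117, 1.1592]`. -/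
theorem rhoD_le_piece2 {δ : ℝ} (h1 : (0.46 : ℝ) ≤ δ) (h2 : δ ≤ 0.55) : rhoD δ ≤ 0.53 := by
  obtain ⟨hH1, hH2⟩ := H23_bounds
  have hHpos := H23_pos
  have hπ1 := Real.pi_gt_d6
  have hπ2 := Real.pi_lt_d6
  have hnum : |Real.sin (Real.pi * δ)| ≤ 1 := Real.abs_sin_le_one _
  have hx1 : 2 * (2 * 0.227925) ≤ Real.pi * δ / H23 := by
    rw [le_div_iff₀ hHpos]; nlinarith [mul_nonneg (sub_nonneg.2 hπ1.le) (sub_nonneg.2 h1)]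
  have hx2 : Real.pi * δ / H23 ≤ 2 * (2 * 0.2898) := by
    rw [div_le_iff₀ hHpos]; nlinarith [mul_nonneg (sub_nonneg.2 hπ2.le) (sub_nonneg.2 h1)]
  have hsin : (0.789867 : ℝ) ≤ Real.sin (Real.pi * δ / H23) :=
    le_sin_of_mem (by norm_num) (by linarith) hx1 hx2 sin_cert_a2 (le_trans (by norm_num) sin_cert_c)
  have hden : (1.5849 : ℝ) * 0.789867 ≤ H23 * |Real.sin (Real.pi * δ / H23)| := by
    rw [abs_of_nonneg (by linarith)]
    exact mul_le_mul hH1 hsin (by norm_num) hHpos.le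
  exact rhoD_le_of_bounds hnum hden (by norm_num) (by norm_num)

/-- P3: `δ ∈ [0.55, 1]` — numerator via `cos (π(δ − 1/2)) ≤ cos 0.157079`, denominator on `[1.09, 1.9823]`
(right end reflected to `1.1592`). -/
theorem rhoD_le_piece3 {δ : ℝ} (h1 : (0.55 : ℝ) ≤ δ) (h2 : δ ≤ 1) : rhoD δ ≤ 0.36 := by
  obtain ⟨hH1, hH2⟩ := H23_bounds
  have hHpos := H23_pos
  have hπ1 := Real.pi_gt_d6
  have hπ2 := Real.pi_lt_d6
  have hnum : |Real.sin (Real.pi * δ)| ≤ 0.987695 := by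
    rw [← Real.cos_sub_pi_div_two (Real.pi * δ)]
    have ht0 : (0.157079 : ℝ) ≤ Real.pi * δ - Real.pi / 2 := by nlinarith
    have ht1 : Real.pi * δ - Real.pi / 2 ≤ Real.pi / 2 := by nlinarith
    have hc0 : 0 ≤ Real.cos (Real.pi * δ - Real.pi / 2) :=
      Real.cos_nonneg_of_neg_pi_div_two_le_of_le (by linarith) ht1
    rw [abs_of_nonneg hc0]
    have hmono : Real.cos (Real.pi * δ - Real.pi / 2) ≤ Real.cos 0.157079 :=
      Real.cos_le_cos_of_nonneg_of_le_pi (by norm_num) (by linarith) ht0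
    have htay := cos_le_taylor (y := (0.157079 : ℝ)) (by norm_num) (by norm_num)
    exact hmono.trans (htay.trans (by norm_num))
  have hx1 : 2 * (2 * 0.2725) ≤ Real.pi * δ / H23 := by
    rw [le_div_iff₀ hHpos]; nlinarith [mul_nonneg (sub_nonneg.2 hπ1.le) (sub_nonneg.2 h1)]
  have hx2 : Real.pi * δ / H23 ≤ 1.9823 := by
    rw [div_le_iff₀ hHpos]; nlinarith [mul_nonneg (sub_nonneg.2 hπ2.le) (sub_nonneg.2 h1)]
  have hb : (0.885031 : ℝ) ≤ Real.sin 1.9823 :=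
    le_sin_of_reflect (le_trans (by norm_num) sin_cert_c) (by norm_num) (by norm_num) (by norm_num)
  have hsin : (0.885031 : ℝ) ≤ Real.sin (Real.pi * δ / H23) :=
    le_sin_of_mem (by norm_num) (by linarith) hx1 hx2 sin_cert_a3 hb
  have hden : (1.5849 : ℝ) * 0.885031 ≤ H23 * |Real.sin (Real.pi * δ / H23)| := by
    rw [abs_of_nonneg (by linarith)]
    exact mul_le_mul hH1 hsin (by norm_num) hHpos.le
  exact rhoD_le_of_bounds hnum hden (by norm_num) (by norm_num)

/-- P4: `δ ∈ [1, 1.135]` — numerator `|sin πδ| = sin (π(δ−1)) ≤ sin 0.424116`, denominator on `[1.982, 2.2499]`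
(both ends reflected). -/
theorem rhoD_le_piece4 {δ : ℝ} (h1 : (1 : ℝ) ≤ δ) (h2 : δ ≤ 1.135) : rhoD δ ≤ 0.041 := by
  obtain ⟨hH1, hH2⟩ := H23_bounds
  have hHpos := H23_pos
  have hπ1 := Real.pi_gt_d6
  have hπ2 := Real.pi_lt_d6
  have hnum : |Real.sin (Real.pi * δ)| ≤ 0.411539 := by
    have hu : Real.sin (Real.pi * δ) = -Real.sin (Real.pi * δ - Real.pi) := by
      rw [Real.sin_sub_pi]; ring
    have hu0 : 0 ≤ Real.pi * δ - Real.pi := by nlinarith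
    have hu1 : Real.pi * δ - Real.pi ≤ 0.424116 := by nlinarith
    have hs0 : 0 ≤ Real.sin (Real.pi * δ - Real.pi) :=
      Real.sin_nonneg_of_nonneg_of_le_pi hu0 (by linarith)
    rw [hu, abs_neg, abs_of_nonneg hs0]
    have hmono : Real.sin (Real.pi * δ - Real.pi) ≤ Real.sin 0.424116 :=
      Real.sin_le_sin_of_le_of_le_pi_div_two (by linarith) (by linarith) hu1
    have htay := sin_le_taylor (x := (0.424116 : ℝ)) (by norm_num) (by norm_num)
    exact hmono.trans (htay.trans (by norm_num))
  have hx1 : (1.982 : ℝ) ≤ Real.pi * δ / H23 := by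
    rw [le_div_iff₀ hHpos]; nlinarith [mul_nonneg (sub_nonneg.2 hπ1.le) (sub_nonneg.2 h1)]
  have hx2 : Real.pi * δ / H23 ≤ 2.2499 := by
    rw [div_le_iff₀ hHpos]; nlinarith [mul_nonneg (sub_nonneg.2 hπ2.le) (sub_nonneg.2 h1)]
  have ha : (0.777518 : ℝ) ≤ Real.sin 1.982 :=
    le_sin_of_reflect (le_trans (by norm_num) sin_cert_c) (by norm_num) (by norm_num) (by norm_num)
  have hb : (0.777518 : ℝ) ≤ Real.sin 2.2499 :=
    le_sin_of_reflect sin_cert_a1 (by norm_num) (by norm_num) (by norm_num)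
  have hsin : (0.777518 : ℝ) ≤ Real.sin (Real.pi * δ / H23) :=
    le_sin_of_mem (by norm_num) (by linarith) hx1 hx2 ha hb
  have hden : (1.5849 : ℝ) * 0.777518 ≤ H23 * |Real.sin (Real.pi * δ / H23)| := by
    rw [abs_of_nonneg (by linarith)]
    exact mul_le_mul hH1 hsin (by norm_num) hHpos.le
  exact rhoD_le_of_bounds hnum hden (by norm_num) (by norm_num)

/-- P5 (`ρ_S`): `δ ∈ [0.45, 0.55]` — numerator `H sin(πδ/H) ≤ 1.585 · sin 1.0904`, denominator
`|sin πδ| = cos|π/2 − πδ| ≥ cos 0.15708 ≥ 1 − 0.15708²/2`. -/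
theorem rhoS_le_piece5 {δ : ℝ} (h1 : (0.45 : ℝ) ≤ δ) (h2 : δ ≤ 0.55) : rhoS δ ≤ 2.95 := by
  obtain ⟨hH1, hH2⟩ := H23_bounds
  have hHpos := H23_pos
  have hπ1 := Real.pi_gt_d6
  have hπ2 := Real.pi_lt_d6
  have hx0 : 0 ≤ Real.pi * δ / H23 := by positivity
  have hx2 : Real.pi * δ / H23 ≤ 2 * (2 * 0.2726) := by
    rw [div_le_iff₀ hHpos]; nlinarith [mul_nonneg (sub_nonneg.2 hπ2.le) (sub_nonneg.2 h1)]
  have hnum : H23 * |Real.sin (Real.pi * δ / H23)| ≤ 1.5850 * 0.886968 := by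
    have hs0 : 0 ≤ Real.sin (Real.pi * δ / H23) :=
      Real.sin_nonneg_of_nonneg_of_le_pi hx0 (by linarith)
    rw [abs_of_nonneg hs0]
    have hmono : Real.sin (Real.pi * δ / H23) ≤ Real.sin (2 * (2 * 0.2726)) :=
      Real.sin_le_sin_of_le_of_le_pi_div_two (by linarith) (by linarith) hx2
    exact mul_le_mul hH2 (hmono.trans sin_cert_u) hs0 (by norm_num)
  have hden : (0.987662 : ℝ) ≤ |Real.sin (Real.pi * δ)| := by
    rw [← Real.cos_pi_div_two_sub (Real.pi * δ), ← Real.cos_abs]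
    have ht : |Real.pi / 2 - Real.pi * δ| ≤ 0.15708 := by
      rw [abs_le]; constructor <;> nlinarith
    have hmono : Real.cos 0.15708 ≤ Real.cos |Real.pi / 2 - Real.pi * δ| :=
      Real.cos_le_cos_of_nonneg_of_le_pi (abs_nonneg _) (by linarith) ht
    have hlow : (0.987662 : ℝ) ≤ Real.cos 0.15708 :=
      le_trans (by norm_num) (Real.one_sub_sq_div_two_le_cos (x := (0.15708 : ℝ)))
    exact (hlow.trans hmono).trans (le_abs_self _)
  exact rhoS_le_of_bounds hnum hden (by norm_num) (by norm_num)

/-! ## The scalar conjuncts -/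

/-- (vi) `e^{-10/3} ≤ 0.036` (via `exp(−1)³ · exp(−1/3)`). -/
theorem exp_neg_ten_thirds_le : Real.exp (-(10 / 3 : ℝ)) ≤ 0.036 := by
  have he1 := Real.exp_neg_one_lt_d9
  have he1pos : 0 < Real.exp (-1) := Real.exp_pos _
  have h3 : Real.exp (-3) = Real.exp (-1) ^ 3 := by
    rw [← Real.exp_nat_mul]; norm_num
  have hsplit : Real.exp (-(10 / 3 : ℝ)) = Real.exp (-3) * Real.exp (-(1 / 3 : ℝ)) := by
    rw [← Real.exp_add]; norm_num
  have hq : (25 / 18 : ℝ) ≤ Real.exp (1 / 3 : ℝ) :=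
    le_trans (by norm_num) (Real.quadratic_le_exp_of_nonneg (x := (1 / 3 : ℝ)) (by norm_num))
  have hprod : Real.exp (-(1 / 3 : ℝ)) * Real.exp (1 / 3 : ℝ) = 1 := by
    rw [← Real.exp_add]; norm_num
  have he3pos : 0 < Real.exp (-(1 / 3 : ℝ)) := Real.exp_pos _
  have he3 : Real.exp (-(1 / 3 : ℝ)) ≤ 18 / 25 := by nlinarith
  have hA : Real.exp (-1) ^ 3 ≤ (0.3678794412 : ℝ) ^ 3 := pow_le_pow_left₀ he1pos.le he1.le 3
  rw [hsplit, h3]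
  calc Real.exp (-1) ^ 3 * Real.exp (-(1 / 3 : ℝ)) ≤ (0.3678794412 : ℝ) ^ 3 * (18 / 25) :=
        mul_le_mul hA he3 he3pos.le (by positivity)
    _ ≤ 0.036 := by norm_num

/-- (vii) `(π · 1.135 / 20)² ≤ 0.032` (via `Real.pi_lt_d6`). -/
theorem pi_term_le : (Real.pi * 1.135 / 20) ^ 2 ≤ (0.032 : ℝ) := by
  have hπ2 := Real.pi_lt_d6
  have hπ0 := Real.pi_pos
  nlinarith [mul_pos hπ0 hπ0]

/-! ## Assembly -/

/-- Stub B of LINE L64: the finite certificate holds. -/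
theorem spillBudget : SpillBudget := by
  refine ⟨H23_bounds, ?_, ?_, ?_, ?_, exp_neg_ten_thirds_le, pi_term_le, by norm_num⟩
  · intro δ h1 h2
    rcases le_or_gt δ 1 with h | h
    · exact rhoD_le_piece3 h1 h
    · exact (rhoD_le_piece4 h.le h2).trans (by norm_num)
  · intro δ h1 h2
    rcases le_or_gt δ 0.46 with h | h
    · exact rhoD_le_piece1 h1 h
    · exact rhoD_le_piece2 h.le h2
  · intro δ h1 h2
    exact rhoS_le_piece5 h1 h2
  · intro δ h1 h2
    exact rhoD_le_piece4 (by linarith) h2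

end Summit.RiemannHypothesis.RiemannHypothesis.Theorems.TwoPrimeFoldRigidity.Negative

end
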